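import Literature.Geometry.DiscreteGeometry.LayerShells
import Literature.Geometry.DiscreteGeometry.SphericalPolygonPerimeter
import HarnessLib

/-!
# Local structure of a soft twelve-shell — part 1/6: the oriented tangent frame
# (route `HullExactificationCascade`, crux `ZeroDefectDensity`, stmt-AtomisticToContinuum-12086;
# line `birth`, stub `stub_localStructure`)

Support file (lead c5, stub-worker K3) for the registered stub `stub_localStructure` of
`Cruxes/ZeroDefectDensity/Lines/birth.lean`: twelve shell points `p i` about a centre `u` (radii
and soft contacts `1 ± 1/4000`, non-contacts `≥ 7/5`) carry a coherent ROTATION `σ v` on the four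
contacts of every shell point `v` — the counter-clockwise successor in the tangent plane at `v`,
oriented by the triple product `orient3` (tree: `SphericalPolygonPerimeter`).  This file is the
frame-free, definition-free toolkit.  For an axis `c` (`= u - p v`) and vectors `x, y`
(`= p a - p v`, …) the frame quantities are FUNCTIONS `R, P, D, S` subject to the defining
equations `hF` (a hypothesis of every lemma; the stub instantiates them by the explicit formulas):

* `R c x = ‖c‖² ‖x‖² - ⟪c, x⟫²` (the squared planar radius of `x`, scaled by `‖c‖²`),
* `P c x y = ‖c‖² ⟪x, y⟫ - ⟪c, x⟫ ⟪c, y⟫` (the planar inner product, scaled by `‖c‖²`),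
* `D c x y = P / (√R √R')` and `S c x y = ‖c‖ orient3 c x y / (√R √R')`, the cosine and the
  sine of the oriented azimuth difference from `x` to `y` about `c`.

We prove: the Lagrange identity `‖c‖² T² = R R' - P²` and the two composition identities
(`rot_lagrange`, `rot_compS`, `rot_compD`, by `ring` in coordinates), whence `D² + S² = 1` and
the rotation law `z(x→z) = z(x→y) z(y→z)` for `z = D + i S` (`rot_unit`, `rot_comp`); the change
of base point `orient3 (c - v) (a - v) (w - v) = orient3 (c - a) (w - a) (v - a)` (`rotT_cyclic`:
the affine orientation of the four points `c, v, a, w` is invariant under even permutations) and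
the fourth-vertex expansion `rotT_fourth`; and the scalar interval lemmas at tolerance `1/4000`
(`rot_point`, `rot_Pcontact`, `rot_Pupper`, `rot_chord_large`, `rot_chord_diag`) used by part 2.
All constants were checked in exact rational arithmetic.

Mathlib + `Literature/Geometry/DiscreteGeometry` (`orient3`, `inner_fin3`, `norm_sq_fin3`) only; no
named fact is used. [folklore]
-/

noncomputable section

namespace Summit.AtomisticToContinuum.Crystallization.Theorems.ZeroDefectDensityBirth

open scoped RealInnerProductSpace
open Literature.Geometry.DiscreteGeometry

/-! ## Polynomial identities of the triple product -/

/-- **Change of base point.**  The orientation `det (c - v, a - v, w - v)` of the four points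
`c, v, a, w` is invariant under the even permutation `v ↦ a ↦ w ↦ v`. [folklore] -/
theorem rotT_cyclic (c v a w : EuclideanSpace ℝ (Fin 3)) :
    orient3 (c - v) (a - v) (w - v) = orient3 (c - a) (w - a) (v - a) := by
  simp only [orient3, PiLp.sub_apply]
  ring

/-- **Fourth-vertex expansion.**  The orientation at a fourth point `W` (relative to the base point
of the frame `c`) in terms of frame quantities:
`‖c‖² det (c - W, B - W, A - W) =`
`T(B,A) (‖c‖² - ⟪c,W⟫) + T(W,B) (‖c‖² - ⟪c,A⟫) + T(A,W) (‖c‖² - ⟪c,B⟫)` (`T = orient3 c`;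
cofactor expansion of the linear dependence of `c, A, B, W` in `ℝ³`). [folklore] -/
theorem rotT_fourth (c W B A : EuclideanSpace ℝ (Fin 3)) :
    ‖c‖ ^ 2 * orient3 (c - W) (B - W) (A - W) =
      orient3 c B A * (‖c‖ ^ 2 - ⟪c, W⟫) + orient3 c W B * (‖c‖ ^ 2 - ⟪c, A⟫) +
        orient3 c A W * (‖c‖ ^ 2 - ⟪c, B⟫) := by
  simp only [orient3, norm_sq_fin3, inner_fin3, PiLp.sub_apply]
  ring

/-! ## Scalar windows at tolerance `1/4000` -/

/-- A band length and its square. [folklore] -/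
theorem rot_band {B : ℝ} (h1 : 1 - 1 / 4000 ≤ B) (h2 : B ≤ 1 + 1 / 4000) :
    0.9995 ≤ B ^ 2 ∧ B ^ 2 ≤ 1.0005001 ∧ 0 < B :=
  ⟨by nlinarith, by nlinarith, by linarith⟩

/-- Axis component `g = ⟪c, x⟫` and scaled planar radius `Rx` of a contact from the three band
lengths (squared) `A2 = ‖c‖²`, `B2 = ‖x‖²`, `D2 = ‖x - c‖²`. [folklore] -/
theorem rot_point {A2 B2 D2 g Rx : ℝ} (hA : 0.9995 ≤ A2) (hA' : A2 ≤ 1.0005001) (hB : 0.9995 ≤ B2)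
    (hB' : B2 ≤ 1.0005001) (hD : 0.9995 ≤ D2) (hD' : D2 ≤ 1.0005001)
    (hg : 2 * g = A2 + B2 - D2) (hR : Rx = A2 * B2 - g ^ 2) :
    0.49924 ≤ g ∧ g ≤ 0.50076 ∧ 0.7482 ≤ Rx ∧ Rx ≤ 0.7518 := by
  have hg1 : 0.49924 ≤ g := by linarith
  have hg2 : g ≤ 0.50076 := by linarith
  refine ⟨hg1, hg2, ?_, ?_⟩
  · rw [hR]
    nlinarith [mul_le_mul hA hB (by norm_num) (by linarith),
      mul_le_mul hg2 hg2 (by linarith) (by norm_num : (0:ℝ) ≤ 0.50076)]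
  · rw [hR]
    nlinarith [mul_le_mul hA' hB' (by linarith) (by norm_num : (0:ℝ) ≤ 1.0005001),
      mul_le_mul hg1 hg1 (by norm_num) (by linarith : (0:ℝ) ≤ g)]

/-- Square root of the scaled planar radius. [folklore] -/
theorem rot_sqrtR {Rx : ℝ} (h1 : 0.7482 ≤ Rx) (h2 : Rx ≤ 0.7518) :
    0.86498 ≤ √Rx ∧ √Rx ≤ 0.86707 := by
  have h0 : 0 ≤ √Rx := Real.sqrt_nonneg Rx
  have hs : √Rx ^ 2 = Rx := Real.sq_sqrt (by linarith)
  exact ⟨by nlinarith, by nlinarith⟩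

/-- Product of two planar radii. [folklore] -/
theorem rot_prodR {s t : ℝ} (hs : 0.86498 ≤ s) (hs' : s ≤ 0.86707) (ht : 0.86498 ≤ t)
    (ht' : t ≤ 0.86707) : 0.74819 ≤ s * t ∧ s * t ≤ 0.75182 :=
  ⟨by nlinarith [mul_le_mul hs ht (by norm_num) (by linarith)],
    by nlinarith [mul_le_mul hs' ht' (by linarith) (by norm_num : (0:ℝ) ≤ 0.86707)]⟩

/-- Planar product of a contact pair. [folklore] -/
theorem rot_Pcontact {A2 gx gy gxy : ℝ} (hA : 0.9995 ≤ A2) (hA' : A2 ≤ 1.0005001)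
    (hx : 0.49924 ≤ gx) (hx' : gx ≤ 0.50076) (hy : 0.49924 ≤ gy) (hy' : gy ≤ 0.50076)
    (hxy : 0.49924 ≤ gxy) (hxy' : gxy ≤ 0.50076) :
    0.24822 ≤ A2 * gxy - gx * gy ∧ A2 * gxy - gx * gy ≤ 0.25178 :=
  ⟨by nlinarith [mul_le_mul hA hxy (by norm_num) (by linarith),
      mul_le_mul hx' hy' (by linarith) (by norm_num : (0:ℝ) ≤ 0.50076)],
    by nlinarith [mul_le_mul hA' hxy' (by linarith) (by norm_num : (0:ℝ) ≤ 1.0005001),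
      mul_le_mul hx hy (by norm_num) (by linarith : (0:ℝ) ≤ gx)]⟩

/-- Planar product of a pair with `⟪x, y⟫ ≤ t`, `t ≥ 0`. [folklore] -/
theorem rot_Pupper {A2 gx gy gxy t : ℝ} (hA : 0.9995 ≤ A2) (hA' : A2 ≤ 1.0005001)
    (hx : 0.49924 ≤ gx) (hy : 0.49924 ≤ gy) (ht : 0 ≤ t) (hxy' : gxy ≤ t) :
    A2 * gxy - gx * gy ≤ 1.0005001 * t - 0.2492405 := by
  nlinarith [mul_le_mul_of_nonneg_left hxy' (by linarith : (0:ℝ) ≤ A2),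
    mul_le_mul hx hy (by norm_num) (by linarith : (0:ℝ) ≤ gx),
    mul_le_mul_of_nonneg_right hA' ht]

/-- Large corner: from `Dv ∈ [-0.40, -0.30]` back to the chord. [folklore] -/
theorem rot_chord_large {A2 Bx2 By2 gx gy gxy st Dv : ℝ} (hA : 0.9995 ≤ A2)
    (hBx : 0.9995 ≤ Bx2) (hBx' : Bx2 ≤ 1.0005001) (hBy : 0.9995 ≤ By2) (hBy' : By2 ≤ 1.0005001)
    (hx : 0.49924 ≤ gx) (hx' : gx ≤ 0.50076) (hy : 0.49924 ≤ gy) (hy' : gy ≤ 0.50076)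
    (hst : 0.74819 ≤ st) (hst' : st ≤ 0.75182) (hD : A2 * gxy - gx * gy = Dv * st)
    (hD1 : -0.40 ≤ Dv) (hD2 : Dv ≤ -0.30) :
    1.94 ≤ Bx2 + By2 - 2 * gxy ∧ Bx2 + By2 - 2 * gxy ≤ 2.11 := by
  have hP1 : -0.30073 ≤ Dv * st := by
    nlinarith [mul_le_mul_of_nonneg_right hD1 (by linarith : (0:ℝ) ≤ st)]
  have hP2 : Dv * st ≤ -0.22445 := by
    nlinarith [mul_le_mul_of_nonneg_right hD2 (by linarith : (0:ℝ) ≤ st)]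
  have hgg1 : 0.24924 ≤ gx * gy := by
    nlinarith [mul_le_mul hx hy (by norm_num) (by linarith : (0:ℝ) ≤ gx)]
  have hgg2 : gx * gy ≤ 0.25077 := by
    nlinarith [mul_le_mul hx' hy' (by linarith) (by norm_num : (0:ℝ) ≤ 0.50076)]
  have hgxy1 : -0.0516 ≤ gxy := by
    by_contra h
    nlinarith [mul_lt_mul_of_pos_left (not_le.mp h) (by linarith : (0:ℝ) < A2)]
  have hgxy2 : gxy ≤ 0.0264 := by
    by_contra h
    nlinarith [mul_lt_mul_of_pos_left (not_le.mp h) (by linarith : (0:ℝ) < A2)]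
  constructor <;> linarith

/-- Diagonal: from `Dv ≤ -0.77` back to the chord. [folklore] -/
theorem rot_chord_diag {A2 Bx2 By2 gx gy gxy st Dv : ℝ} (hA : 0.9995 ≤ A2) (hA' : A2 ≤ 1.0005001)
    (hBx : 0.9995 ≤ Bx2) (hBy : 0.9995 ≤ By2) (hx' : gx ≤ 0.50076) (hy : 0.49924 ≤ gy)
    (hy' : gy ≤ 0.50076) (hst : 0.74819 ≤ st) (hD : A2 * gxy - gx * gy = Dv * st)
    (hD2 : Dv ≤ -0.77) : 2.6 ≤ Bx2 + By2 - 2 * gxy := by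
  have hP2 : Dv * st ≤ -0.5761 := by
    nlinarith [mul_le_mul_of_nonneg_right hD2 (by linarith : (0:ℝ) ≤ st)]
  have hgg2 : gx * gy ≤ 0.25077 := by
    nlinarith [mul_le_mul hx' hy' (by linarith) (by norm_num : (0:ℝ) ≤ 0.50076)]
  have hgxy2 : gxy ≤ -0.325 := by
    by_contra h
    nlinarith [mul_lt_mul_of_pos_left (not_le.mp h) (by linarith : (0:ℝ) < A2)]
  linarith

/-! ## The frame exists; the registered sub-goal of this file -/

/-- **The frame functions exist**: the explicit formulas satisfy the defining equations `hF` used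
throughout parts 1–5 (so every lemma below applies to them). [folklore] -/
theorem rot_frame_exists : ∃ (R : EuclideanSpace ℝ (Fin 3) → EuclideanSpace ℝ (Fin 3) → ℝ)
    (P D S : EuclideanSpace ℝ (Fin 3) → EuclideanSpace ℝ (Fin 3) → EuclideanSpace ℝ (Fin 3) → ℝ),
    (∀ c x, R c x = ‖c‖ ^ 2 * ‖x‖ ^ 2 - ⟪c, x⟫ ^ 2) ∧
    (∀ c x y, P c x y = ‖c‖ ^ 2 * ⟪x, y⟫ - ⟪c, x⟫ * ⟪c, y⟫) ∧
    (∀ c x y, D c x y = P c x y / (√(R c x) * √(R c y))) ∧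
    (∀ c x y, S c x y = ‖c‖ * orient3 c x y / (√(R c x) * √(R c y))) :=
  ⟨fun c x => ‖c‖ ^ 2 * ‖x‖ ^ 2 - ⟪c, x⟫ ^ 2, fun c x y => ‖c‖ ^ 2 * ⟪x, y⟫ - ⟪c, x⟫ * ⟪c, y⟫,
    fun c x y => (‖c‖ ^ 2 * ⟪x, y⟫ - ⟪c, x⟫ * ⟪c, y⟫) /
      (√(‖c‖ ^ 2 * ‖x‖ ^ 2 - ⟪c, x⟫ ^ 2) * √(‖c‖ ^ 2 * ‖y‖ ^ 2 - ⟪c, y⟫ ^ 2)),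
    fun c x y => ‖c‖ * orient3 c x y /
      (√(‖c‖ ^ 2 * ‖x‖ ^ 2 - ⟪c, x⟫ ^ 2) * √(‖c‖ ^ 2 * ‖y‖ ^ 2 - ⟪c, y⟫ ^ 2)),
    fun _ _ => rfl, fun _ _ _ => rfl, fun _ _ _ => rfl, fun _ _ _ => rfl⟩

/-- **The frame identities** (registered sub-goal `rot_frameIdentities` of `stub_localStructure`,
one line): the Lagrange identity and the two composition identities of the triple product in the
plane orthogonal to `c`, written out. [folklore] -/
theorem rot_frameIdentities : ∀ (c x y z : EuclideanSpace ℝ (Fin 3)), ‖c‖ ^ 2 * Literature.Geometry.DiscreteGeometry.orient3 c x y ^ 2 = (‖c‖ ^ 2 * ‖x‖ ^ 2 - inner ℝ c x ^ 2) * (‖c‖ ^ 2 * ‖y‖ ^ 2 - inner ℝ c y ^ 2) - (‖c‖ ^ 2 * inner ℝ x y - inner ℝ c x * inner ℝ c y) ^ 2 ∧ Literature.Geometry.DiscreteGeometry.orient3 c x z * (‖c‖ ^ 2 * ‖y‖ ^ 2 - inner ℝ c y ^ 2) = Literature.Geometry.DiscreteGeometry.orient3 c x y * (‖c‖ ^ 2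 * inner ℝ y z - inner ℝ c y * inner ℝ c z) + (‖c‖ ^ 2 * inner ℝ x y - inner ℝ c x * inner ℝ c y) * Literature.Geometry.DiscreteGeometry.orient3 c y z ∧ (‖c‖ ^ 2 * inner ℝ x z - inner ℝ c x * inner ℝ c z) * (‖c‖ ^ 2 * ‖y‖ ^ 2 - inner ℝ c y ^ 2) = (‖c‖ ^ 2 * inner ℝ x y - inner ℝ c x * inner ℝ c y) * (‖c‖ ^ 2 * inner ℝ y z - inner ℝ c y * inner ℝ c z) - ‖c‖ ^ 2 * (Literature.Geometry.DiscreteGeometry.orient3 c x y * Literature.Geometry.DiscreteGeometry.orient3 c y z) := by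
  intro c x y z
  refine ⟨?_, ?_, ?_⟩ <;> simp only [orient3, norm_sq_fin3, inner_fin3] <;> ring

/-! ## The frame functions `R, P, D, S` -/

variable {R : EuclideanSpace ℝ (Fin 3) → EuclideanSpace ℝ (Fin 3) → ℝ}
  {P D S : EuclideanSpace ℝ (Fin 3) → EuclideanSpace ℝ (Fin 3) → EuclideanSpace ℝ (Fin 3) → ℝ}
  (hF : (∀ c x, R c x = ‖c‖ ^ 2 * ‖x‖ ^ 2 - ⟪c, x⟫ ^ 2) ∧
    (∀ c x y, P c x y = ‖c‖ ^ 2 * ⟪x, y⟫ - ⟪c, x⟫ * ⟪c, y⟫) ∧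
    (∀ c x y, D c x y = P c x y / (√(R c x) * √(R c y))) ∧
    (∀ c x y, S c x y = ‖c‖ * orient3 c x y / (√(R c x) * √(R c y))))
include hF

/-- **Lagrange identity** in the plane orthogonal to `c`: `‖c‖² T² = R R' - P²`. [folklore] -/
theorem rot_lagrange (c x y : EuclideanSpace ℝ (Fin 3)) :
    ‖c‖ ^ 2 * orient3 c x y ^ 2 = R c x * R c y - P c x y ^ 2 := by
  obtain ⟨hR, hP, -, -⟩ := hF
  simp only [hR, hP, orient3, norm_sq_fin3, inner_fin3]
  ring

/-- **Composition, sine part**: `T(x,z) R(y) = T(x,y) P(y,z) + P(x,y) T(y,z)`. [folklore] -/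
theorem rot_compS (c x y z : EuclideanSpace ℝ (Fin 3)) :
    orient3 c x z * R c y = orient3 c x y * P c y z + P c x y * orient3 c y z := by
  obtain ⟨hR, hP, -, -⟩ := hF
  simp only [hR, hP, orient3, norm_sq_fin3, inner_fin3]
  ring

/-- **Composition, cosine part**: `P(x,z) R(y) = P(x,y) P(y,z) - ‖c‖² T(x,y) T(y,z)`.
[folklore] -/
theorem rot_compD (c x y z : EuclideanSpace ℝ (Fin 3)) :
    P c x z * R c y = P c x y * P c y z - ‖c‖ ^ 2 * (orient3 c x y * orient3 c y z) := by
  obtain ⟨hR, hP, -, -⟩ := hF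
  simp only [hR, hP, orient3, norm_sq_fin3, inner_fin3]
  ring

/-- `D` is symmetric. [folklore] -/
theorem rotD_swap (c x y : EuclideanSpace ℝ (Fin 3)) : D c y x = D c x y := by
  obtain ⟨-, hP, hD, -⟩ := hF
  rw [hD, hD, hP, hP, real_inner_comm x y, mul_comm ⟪c, y⟫ ⟪c, x⟫, mul_comm (√(R c y))]

/-- `S` is antisymmetric. [folklore] -/
theorem rotS_swap (c x y : EuclideanSpace ℝ (Fin 3)) : S c y x = -S c x y := by
  obtain ⟨-, -, -, hS⟩ := hF
  rw [hS, hS, orient3_swap_right c y x, mul_comm (√(R c y))]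
  ring

/-- `D² + S² = 1` (from the Lagrange identity). [folklore] -/
theorem rot_unit {c x y : EuclideanSpace ℝ (Fin 3)} (hx : 0 < R c x) (hy : 0 < R c y) :
    D c x y ^ 2 + S c x y ^ 2 = 1 := by
  have h := rot_lagrange hF c x y
  obtain ⟨-, -, hD, hS⟩ := hF
  have hx' : 0 < √(R c x) := Real.sqrt_pos.mpr hx
  have hy' : 0 < √(R c y) := Real.sqrt_pos.mpr hy
  have e1 : √(R c x) ^ 2 = R c x := Real.sq_sqrt hx.le
  have e2 : √(R c y) ^ 2 = R c y := Real.sq_sqrt hy.le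
  rw [hD, hS, div_pow, div_pow, ← add_div, div_eq_one_iff_eq (by positivity)]
  linear_combination h - √(R c y) ^ 2 * e1 - R c x * e2

/-- **Rotation law**: `z(x→z) = z(x→y) · z(y→z)` for `z = D + i S`, i.e.
`D(x,z) = D(x,y) D(y,z) - S(x,y) S(y,z)` and `S(x,z) = S(x,y) D(y,z) + D(x,y) S(y,z)`. [folklore] -/
theorem rot_comp {c x y z : EuclideanSpace ℝ (Fin 3)} (hx : 0 < R c x) (hy : 0 < R c y)
    (hz : 0 < R c z) :
    D c x z = D c x y * D c y z - S c x y * S c y z ∧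
      S c x z = S c x y * D c y z + D c x y * S c y z := by
  have h1 := rot_compD hF c x y z
  have h2 := rot_compS hF c x y z
  obtain ⟨-, -, hD, hS⟩ := hF
  have hx' : 0 < √(R c x) := Real.sqrt_pos.mpr hx
  have hy' : 0 < √(R c y) := Real.sqrt_pos.mpr hy
  have hz' : 0 < √(R c z) := Real.sqrt_pos.mpr hz
  have ey : √(R c y) ^ 2 = R c y := Real.sq_sqrt hy.le
  simp only [hD, hS]
  constructor
  · field_simp
    linear_combination h1 + P c x z * ey
  · field_simp
    linear_combination ‖c‖ * h2 + ‖c‖ * orient3 c x z * ey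

/-- The sign of `S` is the sign of the triple product. [folklore] -/
theorem rotS_pos_iff {c x y : EuclideanSpace ℝ (Fin 3)} (hc : c ≠ 0) (hx : 0 < R c x)
    (hy : 0 < R c y) : 0 < S c x y ↔ 0 < orient3 c x y := by
  obtain ⟨-, -, -, hS⟩ := hF
  rw [hS, div_pos_iff_of_pos_right (mul_pos (Real.sqrt_pos.mpr hx) (Real.sqrt_pos.mpr hy)),
    mul_pos_iff_of_pos_left (norm_pos_iff.mpr hc)]

/-- `orient3` in terms of `S`: `S √R √R' = ‖c‖ T`. [folklore] -/
theorem rotS_mul {c x y : EuclideanSpace ℝ (Fin 3)} (hx : 0 < R c x) (hy : 0 < R c y) :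
    S c x y * (√(R c x) * √(R c y)) = ‖c‖ * orient3 c x y := by
  obtain ⟨-, -, -, hS⟩ := hF
  rw [hS]
  exact div_mul_cancel₀ _ (mul_pos (Real.sqrt_pos.mpr hx) (Real.sqrt_pos.mpr hy)).ne'

/-- `P` in terms of `D`: `D √R √R' = ‖c‖² ⟪x, y⟫ - ⟪c, x⟫ ⟪c, y⟫`. [folklore] -/
theorem rotD_mul {c x y : EuclideanSpace ℝ (Fin 3)} (hx : 0 < R c x) (hy : 0 < R c y) :
    D c x y * (√(R c x) * √(R c y)) = ‖c‖ ^ 2 * ⟪x, y⟫ - ⟪c, x⟫ * ⟪c, y⟫ := by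
  obtain ⟨-, hP, hD, -⟩ := hF
  rw [hD, hP]
  exact div_mul_cancel₀ _ (mul_pos (Real.sqrt_pos.mpr hx) (Real.sqrt_pos.mpr hy)).ne'

/-- Upper bounds on `D` as bounds on the planar product. [folklore] -/
theorem rotD_le_iff {c x y : EuclideanSpace ℝ (Fin 3)} (hx : 0 < R c x) (hy : 0 < R c y)
    (t : ℝ) : D c x y ≤ t ↔ ‖c‖ ^ 2 * ⟪x, y⟫ - ⟪c, x⟫ * ⟪c, y⟫ ≤ t * (√(R c x) * √(R c y)) := by
  obtain ⟨-, hP, hD, -⟩ := hF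
  rw [hD, hP, div_le_iff₀ (mul_pos (Real.sqrt_pos.mpr hx) (Real.sqrt_pos.mpr hy))]

/-- Lower bounds on `D` as bounds on the planar product. [folklore] -/
theorem le_rotD_iff {c x y : EuclideanSpace ℝ (Fin 3)} (hx : 0 < R c x) (hy : 0 < R c y)
    (t : ℝ) : t ≤ D c x y ↔ t * (√(R c x) * √(R c y)) ≤ ‖c‖ ^ 2 * ⟪x, y⟫ - ⟪c, x⟫ * ⟪c, y⟫ := by
  obtain ⟨-, hP, hD, -⟩ := hF
  rw [hD, hP, le_div_iff₀ (mul_pos (Real.sqrt_pos.mpr hx) (Real.sqrt_pos.mpr hy))]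

/-- `D ≤ 0.338` (or any `|D| < 1`) forces `S ≠ 0`. [folklore] -/
theorem rotS_ne_zero {c x y : EuclideanSpace ℝ (Fin 3)} (hx : 0 < R c x) (hy : 0 < R c y)
    (hD : D c x y ≤ 0.338) (hD' : -0.77 < D c x y) : S c x y ≠ 0 := by
  intro h
  have h1 := rot_unit hF hx hy
  rw [h] at h1
  nlinarith

end Summit.AtomisticToContinuum.Crystallization.Theorems.ZeroDefectDensityBirth
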